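import Literature.AnabelianGeometry.SemiGraphs.TemperedCurveOfOpenSubgroup
import HarnessLib

/-!
# `X_H → X_K`: the decomposition groups of the covering surject onto OPEN subgroups of `G_K`, from compactness of `D_x`
# ([SemiAnbd] §6 p. 71) — proof-only companion of `TemperedCurveOfOpenSubgroup`

Mochizuki, *Semi-graphs of anabelioids*, Publ. RIMS **42** (2006), §6 p. 71: "`D_x` always surjects onto an open subgroup of
`G_K`". [cite: MochizukiSemiAnbd2006, §6 p.71]  PROOF-ONLY (abc-iut cell; staged by abc-iut-L6-t7 gen 3 with B15 piece 1;
no definitions): the hypothesis `hDopen` of `TemperedCurve.ofOpenSubgroup` — openness of `aug(H ∩ g D_x g⁻¹)` — is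
DERIVED whenever `D_x` is compact (abc-iut-L3's `Thm68Sub.DecompCompact`, a theorem under `GroupLevelData`:
`decompCompact_of_groupLevelData`): `H ∩ gD_xg⁻¹` is open, hence of finite index, in the compact group `gD_xg⁻¹`; its image
`V` under the augmentation is compact, hence closed, and finitely many translates of `V` cover the OPEN subgroup
`aug(gD_xg⁻¹)`; a finite union of closed sets with empty interior has empty interior, so `V` has nonempty interior, i.e. the
subgroup `V` is open.  Classical topological group theory; nothing of [IUTchIII] is touched.
-/

noncomputable section

namespace Literature.AnabelianGeometry.SemiGraphs

open _root_.Topology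
open scoped Pointwise

namespace TemperedCurve

variable {p : ℕ} [Fact p.Prime] (X : TemperedCurve p) (H : Subgroup X.PiTemp)

/-! ### `D_y ↠ open ≤ G_K` from compactness of `D_x` -/

/-- In any topological space, if a FINITE union of closed sets has nonempty interior, one of them has nonempty
interior (elementary: `interior (s ∪ t) = interior s` for `t` closed with empty interior). [folklore] -/
private theorem exists_interior_nonempty_of_iUnion {Y : Type*} [TopologicalSpace Y] {ι : Type*} [Finite ι]
    (f : ι → Set Y) (hc : ∀ i, IsClosed (f i)) (hne : (interior (⋃ i, f i)).Nonempty) :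
    ∃ i, (interior (f i)).Nonempty := by
  classical
  by_contra hall
  have hall' : ∀ i, interior (f i) = ∅ := fun i =>
    Set.not_nonempty_iff_eq_empty.mp fun h => hall ⟨i, h⟩
  haveI := Fintype.ofFinite ι
  have key : ∀ s : Finset ι, interior (⋃ i ∈ s, f i) = ∅ := by
    intro s
    induction s using Finset.induction_on with
    | empty => simp
    | @insert a s ha ih =>
      rw [Finset.set_biUnion_insert, Set.union_comm,
        interior_union_isClosed_of_interior_empty (isClosed_biUnion_finset fun i _ => hc i)
          (hall' a), ih]
  have huniv : (⋃ i, f i) = ⋃ i ∈ (Finset.univ : Finset ι), f i := by simp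
  rw [huniv, key] at hne
  exact Set.not_nonempty_empty hne

/-- **`D_y` surjects onto an OPEN subgroup of `G_{K'}`, from compactness of `D_x`** ([SemiAnbd] §6 p. 71 "`D_x` always
surjects onto an open subgroup of `G_K`"; compactness of `D_x` is abc-iut-L3's `Thm68Sub.DecompCompact`, a theorem under
`GroupLevelData` — `decompCompact_of_groupLevelData`): `aug(H ∩ gD_xg⁻¹)` is a compact (hence closed) subgroup of
`G_{ℚ_p}` of finite index in the open subgroup `aug(gD_xg⁻¹)` (`H ∩ gD_xg⁻¹` is open, so of finite index, in the compact
`gD_xg⁻¹`), hence open. So the hypothesis `hDopen` of `ofOpenSubgroup` is DISCHARGED whenever every `D_x` is compact.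
[cite: MochizukiSemiAnbd2006, §6 p.71] -/
theorem isOpen_image_aug_decompOfOpenAt_of_isCompact (hHo : IsOpen (H : Set X.PiTemp)) (x : X.Pt) (g : X.PiTemp)
    (hDx : IsCompact (X.decomp x : Set X.PiTemp)) :
    IsOpen (X.aug '' ((X.decompOfOpenAt H x g).map H.subtype : Set X.PiTemp)) := by
  classical
  haveI : IsGalois ℚ_[p] (AlgebraicClosure ℚ_[p]) := {}
  haveI : T2Space (GQp p) := krullTopology_t2
  -- the conjugate `K := g D_x g⁻¹`, a compact subgroup containing the closed subgroup `H ∩ K`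
  let K : Subgroup X.PiTemp := (X.decomp x).comap (MulAut.conj g⁻¹).toMonoidHom
  have hKmem : ∀ {y : X.PiTemp}, y ∈ K ↔ g⁻¹ * y * g⁻¹⁻¹ ∈ X.decomp x := fun {y} => Iff.rfl
  have hKeq : (K : Set X.PiTemp) = (fun d : X.PiTemp => g * d * g⁻¹) '' (X.decomp x : Set X.PiTemp) := by
    ext y
    simp only [SetLike.mem_coe, Set.mem_image]
    constructor
    · intro hy
      exact ⟨g⁻¹ * y * g⁻¹⁻¹, hKmem.mp hy, by group⟩
    · rintro ⟨d, hd, rfl⟩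
      apply hKmem.mpr
      have : g⁻¹ * (g * d * g⁻¹) * g⁻¹⁻¹ = d := by group
      rw [this]; exact hd
  have hKc : IsCompact (K : Set X.PiTemp) := by
    rw [hKeq]
    exact hDx.image ((continuous_const.mul continuous_id).mul continuous_const)
  -- the set of the statement is `H ∩ K`
  have hHK : (((X.decompOfOpenAt H x g).map H.subtype : Subgroup X.PiTemp) : Set X.PiTemp) =
      (H : Set X.PiTemp) ∩ (K : Set X.PiTemp) := by
    ext y
    simp only [Subgroup.coe_map, Set.mem_image, SetLike.mem_coe, Set.mem_inter_iff]
    constructor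
    · rintro ⟨h, hh, rfl⟩
      exact ⟨h.2, hh⟩
    · rintro ⟨hyH, hyK⟩
      exact ⟨⟨y, hyH⟩, hyK, rfl⟩
  have hHKc : IsCompact ((H : Set X.PiTemp) ∩ (K : Set X.PiTemp)) :=
    hKc.inter_left (Subgroup.isClosed_of_isOpen H hHo)
  -- `V := aug(H ∩ K)`, a compact hence closed subgroup of `G_{ℚ_p}`; `W := aug(K)` is open
  let Vsub : Subgroup (GQp p) := ((X.decompOfOpenAt H x g).map H.subtype).map X.aug.toMonoidHom
  have hVeq : (Vsub : Set (GQp p)) = X.aug '' ((H : Set X.PiTemp) ∩ (K : Set X.PiTemp)) := by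
    rw [Subgroup.coe_map, hHK]; rfl
  have hVc : IsCompact (Vsub : Set (GQp p)) := by
    rw [hVeq]; exact hHKc.image X.aug.continuous
  have hVclosed : IsClosed (Vsub : Set (GQp p)) := hVc.isClosed
  have hWo : IsOpen (X.aug '' (K : Set X.PiTemp)) := by
    rw [hKeq, Set.image_image]
    have : (fun d : X.PiTemp => X.aug (g * d * g⁻¹)) = (fun t : GQp p => X.aug g * t * (X.aug g)⁻¹) ∘ X.aug := by
      funext d; simp [map_mul]
    rw [this, Set.image_comp]
    exact (((Homeomorph.mulLeft (X.aug g)).trans (Homeomorph.mulRight (X.aug g)⁻¹)).isOpenMap) _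
      (X.isOpen_aug_decomp x)
  -- `H ∩ K` is open, hence of finite index, in the compact group `K`
  haveI : CompactSpace K := isCompact_iff_compactSpace.mp hKc
  let U : Subgroup K := H.subgroupOf K
  have hUo : IsOpen (U : Set K) := hHo.preimage continuous_subtype_val
  haveI : Finite (K ⧸ U) := Subgroup.quotient_finite_of_isOpen U hUo
  -- `W ⊆ ⋃_{q : K/U} aug(q.out) · V`
  let c : K ⧸ U → GQp p := fun q => X.aug (q.out : K)
  have hWsub : X.aug '' (K : Set X.PiTemp) ⊆ ⋃ q : K ⧸ U, (fun t => c q * t) '' (Vsub : Set (GQp p)) := by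
    rintro _ ⟨k, hk, rfl⟩
    rw [Set.mem_iUnion]
    refine ⟨QuotientGroup.mk (⟨k, hk⟩ : K), ?_⟩
    obtain ⟨u, hu⟩ := QuotientGroup.mk_out_eq_mul U (⟨k, hk⟩ : K)
    -- `q.out = k * u`, `u ∈ U = H ∩ K`; so `aug k = aug(q.out) * aug(u⁻¹)`
    refine ⟨X.aug ((u : K) : X.PiTemp)⁻¹, ?_, ?_⟩
    · rw [hVeq]
      refine ⟨((u⁻¹ : U) : K), ⟨?_, ((u⁻¹ : U) : K).2⟩, by simp⟩
      exact (u⁻¹).2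
    · change X.aug ((QuotientGroup.mk (⟨k, hk⟩ : K) : K ⧸ U).out : K) * X.aug ((u : K) : X.PiTemp)⁻¹ = X.aug k
      rw [hu]
      simp [map_mul]
  -- some translate of `V`, hence `V` itself, has nonempty interior
  have hne : (interior (⋃ q : K ⧸ U, (fun t => c q * t) '' (Vsub : Set (GQp p)))).Nonempty := by
    refine ⟨X.aug 1, interior_mono hWsub ?_⟩
    rw [hWo.interior_eq]
    exact ⟨1, K.one_mem, rfl⟩
  obtain ⟨q, hq⟩ := exists_interior_nonempty_of_iUnion _
    (fun q => (Homeomorph.mulLeft (c q)).isClosedMap _ hVclosed) hne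
  have hVint : (interior (Vsub : Set (GQp p))).Nonempty := by
    have himg : (fun t => c q * t) '' (Vsub : Set (GQp p)) = (Homeomorph.mulLeft (c q)) '' (Vsub : Set (GQp p)) := rfl
    have hq' : (interior ((Homeomorph.mulLeft (c q)) '' (Vsub : Set (GQp p)))).Nonempty := by
      rw [← himg]; exact hq
    rw [← (Homeomorph.mulLeft (c q)).image_interior] at hq'
    obtain ⟨_, ⟨v, hv, rfl⟩⟩ := hq'
    exact ⟨v, hv⟩
  obtain ⟨v₀, hv₀⟩ := hVint
  have hVopen : IsOpen (Vsub : Set (GQp p)) := Vsub.isOpen_of_mem_nhds (mem_interior_iff_mem_nhds.mp hv₀)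
  -- done: the set of the statement is `V`
  have : X.aug '' (((X.decompOfOpenAt H x g).map H.subtype : Subgroup X.PiTemp) : Set X.PiTemp) =
      (Vsub : Set (GQp p)) := by
    rw [Subgroup.coe_map]; rfl
  rw [this]
  exact hVopen

/-- Hence, when ALL `D_x` are compact (abc-iut-L3's `Thm68Sub.DecompCompact`, e.g. from `GroupLevelData`), the hypothesis
`hDopen` of `ofOpenSubgroup` holds. [cite: MochizukiSemiAnbd2006, §6 p.71] -/
theorem hDopen_of_isCompact_decomp (hHo : IsOpen (H : Set X.PiTemp))
    (hc : ∀ x : X.Pt, IsCompact (X.decomp x : Set X.PiTemp)) (x : X.Pt) (g : X.PiTemp) :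
    IsOpen (X.aug '' ((X.decompOfOpenAt H x g).map H.subtype : Set X.PiTemp)) :=
  X.isOpen_image_aug_decompOfOpenAt_of_isCompact H hHo x g (hc x)

end TemperedCurve

end Literature.AnabelianGeometry.SemiGraphs

end
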